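import Summits.QuantumFields.YangMills.Theorems.AllWindowsColdBoxBoxHighLineQuarticVertexWick

/-!
# `ConnectedThreePoint`, QUARTIC vertices: two centred quadratic FORMS against a quartic monomial — `E₀[Q_AQ_BN] − E₀[Q_AQ_B]E₀[N] = Σ L⁰L^T·(72 connected
# pairings)`, process level and in the chart (U5-BLOCKERS §2, lift L2 / ASSEMBLY-U5 §3)

Width seat `ym-line-sfw-p2-w3` (g41), cell ym-idea-1; U5 prep, helper-grade.  Linear extension of ✓`…QuarticVertexWick` (`integral_wick2_wick2_mul_four_connected`:
two centred PAIRS against a quartic monomial) to two centred quadratic FORMS `Q_A = Σ_{aa'} L⁰_{aa'}(X_aX_{a'} − C_{aa'})`, `Q_B = Σ_{bb'} L^T_{bb'}(X_bX_{b'} − C_{bb'})`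
(in the chart: `linCurvSq₀ − E₀linCurvSq₀`, `linCurvSq_T − E₀linCurvSq_T` with `L = Λ⊗Λ` colour-diagonal rank-one, ✓`Cum3Triangle.linCurvSq_eq_quadVal`):

* `WickPairCubic.integral_wick2_mul_wick2` — `E[(X_aX_{a'} − C_{aa'})(X_bX_{b'} − C_{bb'})] = C_{ab}C_{a'b'} + C_{ab'}C_{a'b}`;
* ★★ `WickPairCubic.integral_centredForm_centredForm_mul_four_connected` (process level):
  `∫ Q_AQ_B·N − (∫ Q_AQ_B)·(∫ N) = Σ_{aa'bb'} L⁰_{aa'}L^T_{bb'}·(72 connected pairings)`, `N = X_{n₀}X_{n₁}X_{n₂}X_{n₃}`;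
* ★★ `gauss_centredForm_centredForm_mul_four_connected` — the same under `E₀ = (∫ · e^{−βvᵀPv})/(∫ e^{−βvᵀPv})`, `S = (2β)⁻¹P⁻¹`.
Rank-one collapse («X» terms = `D⁰·D^T`, «tadpoles» = `K(0,T)`·gradient·gradient·`S(n,n)`) and cold-box sizes: next files (pattern of ✓`…WickPairCubicForm/ColdBox`).

Tree + Mathlib only; no definitions; standard axioms.  HONEST LABEL: a tool for the RECORDED lift L2 of the NEXT rung U5 (⟨stmt-QuantumFields-24336⟩, UNSTAFFED);
⟨24004⟩ ⟨24336⟩ remain OPEN; route AllWindowsColdBox is DRAFT; no crux, rung or summit is proved; **the Yang–Mills mass gap is NOT proved by this file; no summit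
is proved by a line.**
-/

set_option autoImplicit false

noncomputable section

open MeasureTheory ProbabilityTheory Matrix Finset
open Literature.Probability.Distributions.GaussianWick
open Summit.QuantumFields.YangMills.Theorems.AllWindowsColdBox.CubicChaos (integrable_mul_six integral_mul_four)

namespace Summit.QuantumFields.YangMills.Theorems.AllWindowsColdBoxBoxHighLine

namespace WickPairCubic

variable {T Ω : Type*} {mΩ : MeasurableSpace Ω} {P : Measure Ω} {X : T → Ω → ℝ}

/-- `E[(X_aX_{a'} − C_{aa'})(X_bX_{b'} − C_{bb'})] = C_{ab}C_{a'b'} + C_{ab'}C_{a'b}`. -/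
theorem integral_wick2_mul_wick2 (hX : IsGaussianProcess X P) (h0 : ∀ s, ∫ ω, X s ω ∂P = 0) (C : T → T → ℝ)
    (hC : ∀ s s', C s s' = ∫ ω, X s ω * X s' ω ∂P) (a a' b b' : T) :
    ∫ ω, (X a ω * X a' ω - C a a') * (X b ω * X b' ω - C b b') ∂P = C a b * C a' b' + C a b' * C a' b := by
  have := hX.isProbabilityMeasure
  have hre : ∀ ω, (X a ω * X a' ω - C a a') * (X b ω * X b' ω - C b b') =
      X a ω * X a' ω * X b ω * X b' ω - C b b' * (X a ω * X a' ω) - C a a' * (X b ω * X b' ω) + C a a' * C b b' := fun ω => by ring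
  simp_rw [hre]
  have i4 := QuadCum3.integrable_mul_four hX a a' b b'
  have i2a : Integrable (fun ω => C b b' * (X a ω * X a' ω)) P := (QuadCum3.integrable_mul_two hX a a').const_mul _
  have i2b : Integrable (fun ω => C a a' * (X b ω * X b' ω)) P := (QuadCum3.integrable_mul_two hX b b').const_mul _
  have i4a : Integrable (fun ω => X a ω * X a' ω * X b ω * X b' ω - C b b' * (X a ω * X a' ω)) P := i4.sub i2a
  have i4b : Integrable (fun ω => X a ω * X a' ω * X b ω * X b' ω - C b b' * (X a ω * X a' ω) - C a a' * (X b ω * X b' ω)) P :=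
    i4a.sub i2b
  rw [integral_add i4b (integrable_const _), integral_sub i4a i2b, integral_sub i4 i2a, integral_const_mul, integral_const_mul,
    integral_const, smul_eq_mul, probReal_univ, one_mul, integral_mul_four hX h0]
  simp only [← hC]
  ring

/-- The integrand of the two-form version is integrable term by term. -/
theorem integrable_coeff_wick2_wick2_mul_four (hX : IsGaussianProcess X P) (c c' κ₀ : ℝ) (a a' b b' n₀ n₁ n₂ n₃ : T) :
    Integrable (fun ω => κ₀ * ((X a ω * X a' ω - c) * (X b ω * X b' ω - c') * (X n₀ ω * X n₁ ω * X n₂ ω * X n₃ ω))) P := by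
  have i8 := integrable_mul_eight hX a a' b b' n₀ n₁ n₂ n₃
  have i6a := (integrable_mul_six hX a a' n₀ n₁ n₂ n₃).const_mul c'
  have i6b := (integrable_mul_six hX b b' n₀ n₁ n₂ n₃).const_mul c
  have i4 := (QuadCum3.integrable_mul_four hX n₀ n₁ n₂ n₃).const_mul (c * c')
  refine (((i8.sub i6a).sub i6b).add i4).const_mul κ₀ |>.congr (ae_of_all _ fun ω => ?_)
  simp only [Pi.add_apply, Pi.sub_apply]
  ring

/-- ★★ **Two centred quadratic forms against a quartic monomial, connected part** (process level). -/
theorem integral_centredForm_centredForm_mul_four_connected (hX : IsGaussianProcess X P) (h0 : ∀ s, ∫ ω, X s ω ∂P = 0)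
    {κ : Type*} [Fintype κ] (t : κ → T) (C : T → T → ℝ) (hC : ∀ s s', C s s' = ∫ ω, X s ω * X s' ω ∂P) (LA LB : κ → κ → ℝ)
    (n₀ n₁ n₂ n₃ : κ) {QA QB : Ω → ℝ} (hQA : ∀ ω, QA ω = ∑ a, ∑ a', LA a a' * (X (t a) ω * X (t a') ω - C (t a) (t a')))
    (hQB : ∀ ω, QB ω = ∑ b, ∑ b', LB b b' * (X (t b) ω * X (t b') ω - C (t b) (t b'))) :
    (∫ ω, QA ω * QB ω * (X (t n₀) ω * X (t n₁) ω * X (t n₂) ω * X (t n₃) ω) ∂P) -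
        (∫ ω, QA ω * QB ω ∂P) * ∫ ω, X (t n₀) ω * X (t n₁) ω * X (t n₂) ω * X (t n₃) ω ∂P =
      ∑ a, ∑ a', ∑ b, ∑ b', LA a a' * LB b b' *
        (C (t a) (t b) * C (t a') (t n₀) * C (t b') (t n₁) * C (t n₂) (t n₃) +
        C (t a) (t b) * C (t a') (t n₀) * C (t b') (t n₂) * C (t n₁) (t n₃) +
        C (t a) (t b) * C (t a') (t n₀) * C (t b') (t n₃) * C (t n₁) (t n₂) +
        C (t a) (t b) * C (t a') (t n₁) * C (t b') (t n₀) * C (t n₂) (t n₃) +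
        C (t a) (t b) * C (t a') (t n₁) * C (t b') (t n₂) * C (t n₀) (t n₃) +
        C (t a) (t b) * C (t a') (t n₁) * C (t b') (t n₃) * C (t n₀) (t n₂) +
        C (t a) (t b) * C (t a') (t n₂) * C (t b') (t n₀) * C (t n₁) (t n₃) +
        C (t a) (t b) * C (t a') (t n₂) * C (t b') (t n₁) * C (t n₀) (t n₃) +
        C (t a) (t b) * C (t a') (t n₂) * C (t b') (t n₃) * C (t n₀) (t n₁) +
        C (t a) (t b) * C (t a') (t n₃) * C (t b') (t n₀) * C (t n₁) (t n₂) +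
        C (t a) (t b) * C (t a') (t n₃) * C (t b') (t n₁) * C (t n₀) (t n₂) +
        C (t a) (t b) * C (t a') (t n₃) * C (t b') (t n₂) * C (t n₀) (t n₁) +
        C (t a) (t b') * C (t a') (t n₀) * C (t b) (t n₁) * C (t n₂) (t n₃) +
        C (t a) (t b') * C (t a') (t n₀) * C (t b) (t n₂) * C (t n₁) (t n₃) +
        C (t a) (t b') * C (t a') (t n₀) * C (t b) (t n₃) * C (t n₁) (t n₂) +
        C (t a) (t b') * C (t a') (t n₁) * C (t b) (t n₀) * C (t n₂) (t n₃) +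
        C (t a) (t b') * C (t a') (t n₁) * C (t b) (t n₂) * C (t n₀) (t n₃) +
        C (t a) (t b') * C (t a') (t n₁) * C (t b) (t n₃) * C (t n₀) (t n₂) +
        C (t a) (t b') * C (t a') (t n₂) * C (t b) (t n₀) * C (t n₁) (t n₃) +
        C (t a) (t b') * C (t a') (t n₂) * C (t b) (t n₁) * C (t n₀) (t n₃) +
        C (t a) (t b') * C (t a') (t n₂) * C (t b) (t n₃) * C (t n₀) (t n₁) +
        C (t a) (t b') * C (t a') (t n₃) * C (t b) (t n₀) * C (t n₁) (t n₂) +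
        C (t a) (t b') * C (t a') (t n₃) * C (t b) (t n₁) * C (t n₀) (t n₂) +
        C (t a) (t b') * C (t a') (t n₃) * C (t b) (t n₂) * C (t n₀) (t n₁) +
        C (t a) (t n₀) * C (t a') (t b) * C (t b') (t n₁) * C (t n₂) (t n₃) +
        C (t a) (t n₀) * C (t a') (t b) * C (t b') (t n₂) * C (t n₁) (t n₃) +
        C (t a) (t n₀) * C (t a') (t b) * C (t b') (t n₃) * C (t n₁) (t n₂) +
        C (t a) (t n₀) * C (t a') (t b') * C (t b) (t n₁) * C (t n₂) (t n₃) +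
        C (t a) (t n₀) * C (t a') (t b') * C (t b) (t n₂) * C (t n₁) (t n₃) +
        C (t a) (t n₀) * C (t a') (t b') * C (t b) (t n₃) * C (t n₁) (t n₂) +
        C (t a) (t n₀) * C (t a') (t n₁) * C (t b) (t n₂) * C (t b') (t n₃) +
        C (t a) (t n₀) * C (t a') (t n₁) * C (t b) (t n₃) * C (t b') (t n₂) +
        C (t a) (t n₀) * C (t a') (t n₂) * C (t b) (t n₁) * C (t b') (t n₃) +
        C (t a) (t n₀) * C (t a') (t n₂) * C (t b) (t n₃) * C (t b') (t n₁) +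
        C (t a) (t n₀) * C (t a') (t n₃) * C (t b) (t n₁) * C (t b') (t n₂) +
        C (t a) (t n₀) * C (t a') (t n₃) * C (t b) (t n₂) * C (t b') (t n₁) +
        C (t a) (t n₁) * C (t a') (t b) * C (t b') (t n₀) * C (t n₂) (t n₃) +
        C (t a) (t n₁) * C (t a') (t b) * C (t b') (t n₂) * C (t n₀) (t n₃) +
        C (t a) (t n₁) * C (t a') (t b) * C (t b') (t n₃) * C (t n₀) (t n₂) +
        C (t a) (t n₁) * C (t a') (t b') * C (t b) (t n₀) * C (t n₂) (t n₃) +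
        C (t a) (t n₁) * C (t a') (t b') * C (t b) (t n₂) * C (t n₀) (t n₃) +
        C (t a) (t n₁) * C (t a') (t b') * C (t b) (t n₃) * C (t n₀) (t n₂) +
        C (t a) (t n₁) * C (t a') (t n₀) * C (t b) (t n₂) * C (t b') (t n₃) +
        C (t a) (t n₁) * C (t a') (t n₀) * C (t b) (t n₃) * C (t b') (t n₂) +
        C (t a) (t n₁) * C (t a') (t n₂) * C (t b) (t n₀) * C (t b') (t n₃) +
        C (t a) (t n₁) * C (t a') (t n₂) * C (t b) (t n₃) * C (t b') (t n₀) +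
        C (t a) (t n₁) * C (t a') (t n₃) * C (t b) (t n₀) * C (t b') (t n₂) +
        C (t a) (t n₁) * C (t a') (t n₃) * C (t b) (t n₂) * C (t b') (t n₀) +
        C (t a) (t n₂) * C (t a') (t b) * C (t b') (t n₀) * C (t n₁) (t n₃) +
        C (t a) (t n₂) * C (t a') (t b) * C (t b') (t n₁) * C (t n₀) (t n₃) +
        C (t a) (t n₂) * C (t a') (t b) * C (t b') (t n₃) * C (t n₀) (t n₁) +
        C (t a) (t n₂) * C (t a') (t b') * C (t b) (t n₀) * C (t n₁) (t n₃) +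
        C (t a) (t n₂) * C (t a') (t b') * C (t b) (t n₁) * C (t n₀) (t n₃) +
        C (t a) (t n₂) * C (t a') (t b') * C (t b) (t n₃) * C (t n₀) (t n₁) +
        C (t a) (t n₂) * C (t a') (t n₀) * C (t b) (t n₁) * C (t b') (t n₃) +
        C (t a) (t n₂) * C (t a') (t n₀) * C (t b) (t n₃) * C (t b') (t n₁) +
        C (t a) (t n₂) * C (t a') (t n₁) * C (t b) (t n₀) * C (t b') (t n₃) +
        C (t a) (t n₂) * C (t a') (t n₁) * C (t b) (t n₃) * C (t b') (t n₀) +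
        C (t a) (t n₂) * C (t a') (t n₃) * C (t b) (t n₀) * C (t b') (t n₁) +
        C (t a) (t n₂) * C (t a') (t n₃) * C (t b) (t n₁) * C (t b') (t n₀) +
        C (t a) (t n₃) * C (t a') (t b) * C (t b') (t n₀) * C (t n₁) (t n₂) +
        C (t a) (t n₃) * C (t a') (t b) * C (t b') (t n₁) * C (t n₀) (t n₂) +
        C (t a) (t n₃) * C (t a') (t b) * C (t b') (t n₂) * C (t n₀) (t n₁) +
        C (t a) (t n₃) * C (t a') (t b') * C (t b) (t n₀) * C (t n₁) (t n₂) +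
        C (t a) (t n₃) * C (t a') (t b') * C (t b) (t n₁) * C (t n₀) (t n₂) +
        C (t a) (t n₃) * C (t a') (t b') * C (t b) (t n₂) * C (t n₀) (t n₁) +
        C (t a) (t n₃) * C (t a') (t n₀) * C (t b) (t n₁) * C (t b') (t n₂) +
        C (t a) (t n₃) * C (t a') (t n₀) * C (t b) (t n₂) * C (t b') (t n₁) +
        C (t a) (t n₃) * C (t a') (t n₁) * C (t b) (t n₀) * C (t b') (t n₂) +
        C (t a) (t n₃) * C (t a') (t n₁) * C (t b) (t n₂) * C (t b') (t n₀) +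
        C (t a) (t n₃) * C (t a') (t n₂) * C (t b) (t n₀) * C (t b') (t n₁) +
        C (t a) (t n₃) * C (t a') (t n₂) * C (t b) (t n₁) * C (t b') (t n₀)) := by
  classical
  have := hX.isProbabilityMeasure
  -- expand both forms
  have hprod : ∀ ω, QA ω * QB ω = ∑ a, ∑ a', ∑ b, ∑ b', LA a a' * LB b b' *
      ((X (t a) ω * X (t a') ω - C (t a) (t a')) * (X (t b) ω * X (t b') ω - C (t b) (t b'))) := by
    intro ω
    rw [hQA ω, hQB ω, QuadCum3.sum2_mul_sum2]
    exact QuadCum3.sum4_congr fun _ _ _ _ => by ring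
  have hprodN : ∀ ω, QA ω * QB ω * (X (t n₀) ω * X (t n₁) ω * X (t n₂) ω * X (t n₃) ω) =
      ∑ a, ∑ a', ∑ b, ∑ b', LA a a' * LB b b' * ((X (t a) ω * X (t a') ω - C (t a) (t a')) *
        (X (t b) ω * X (t b') ω - C (t b) (t b')) * (X (t n₀) ω * X (t n₁) ω * X (t n₂) ω * X (t n₃) ω)) := by
    intro ω
    rw [hprod ω, Finset.sum_mul]; refine Finset.sum_congr rfl fun a _ => ?_
    rw [Finset.sum_mul]; refine Finset.sum_congr rfl fun a' _ => ?_
    rw [Finset.sum_mul]; refine Finset.sum_congr rfl fun b _ => ?_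
    rw [Finset.sum_mul]; exact Finset.sum_congr rfl fun b' _ => by ring
  simp_rw [hprodN]
  have hintN : ∀ a a' b b', Integrable (fun ω => LA a a' * LB b b' * ((X (t a) ω * X (t a') ω - C (t a) (t a')) *
      (X (t b) ω * X (t b') ω - C (t b) (t b')) * (X (t n₀) ω * X (t n₁) ω * X (t n₂) ω * X (t n₃) ω))) P :=
    fun a a' b b' => integrable_coeff_wick2_wick2_mul_four hX _ _ _ _ _ _ _ _ _ _ _
  have hint2 : ∀ a a' b b', Integrable (fun ω => LA a a' * LB b b' *
      ((X (t a) ω * X (t a') ω - C (t a) (t a')) * (X (t b) ω * X (t b') ω - C (t b) (t b')))) P := by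
    intro a a' b b'
    have i4 := QuadCum3.integrable_mul_four hX (t a) (t a') (t b) (t b')
    have i2a := (QuadCum3.integrable_mul_two hX (t a) (t a')).const_mul (C (t b) (t b'))
    have i2b := (QuadCum3.integrable_mul_two hX (t b) (t b')).const_mul (C (t a) (t a'))
    refine (((i4.sub i2a).sub i2b).add (integrable_const (C (t a) (t a') * C (t b) (t b')))).const_mul (LA a a' * LB b b')
      |>.congr (ae_of_all _ fun ω => ?_)
    simp only [Pi.add_apply, Pi.sub_apply]
    ring
  have hswapN : ∫ ω, ∑ a, ∑ a', ∑ b, ∑ b', LA a a' * LB b b' * ((X (t a) ω * X (t a') ω - C (t a) (t a')) *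
        (X (t b) ω * X (t b') ω - C (t b) (t b')) * (X (t n₀) ω * X (t n₁) ω * X (t n₂) ω * X (t n₃) ω)) ∂P =
      ∑ a, ∑ a', ∑ b, ∑ b', ∫ ω, LA a a' * LB b b' * ((X (t a) ω * X (t a') ω - C (t a) (t a')) *
        (X (t b) ω * X (t b') ω - C (t b) (t b')) * (X (t n₀) ω * X (t n₁) ω * X (t n₂) ω * X (t n₃) ω)) ∂P := by
    simp_rw [QuadCum3.sum4_eq_sum_prod]
    rw [integral_finsetSum _ fun z _ => hintN _ _ _ _]
  have hswap2 : ∫ ω, QA ω * QB ω ∂P = ∑ a, ∑ a', ∑ b, ∑ b', ∫ ω, LA a a' * LB b b' *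
      ((X (t a) ω * X (t a') ω - C (t a) (t a')) * (X (t b) ω * X (t b') ω - C (t b) (t b'))) ∂P := by
    simp_rw [hprod, QuadCum3.sum4_eq_sum_prod]
    rw [integral_finsetSum _ fun z _ => hint2 _ _ _ _]
  rw [hswapN, hswap2]
  simp only [Finset.sum_mul, ← Finset.sum_sub_distrib]
  refine QuadCum3.sum4_congr fun a a' b b' => ?_
  rw [integral_const_mul, integral_const_mul, integral_wick2_mul_wick2 hX h0 C hC,
    ← integral_wick2_wick2_mul_four_connected hX h0 C hC (t a) (t a') (t b) (t b') (t n₀) (t n₁) (t n₂) (t n₃)]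
  ring

end WickPairCubic

open GaussianChartWick

/-! ## In the chart -/

section Chart

variable {ι : Type*} [Fintype ι] [DecidableEq ι]

/-- ★★ **Two centred quadratic forms against a quartic monomial, connected part, in the chart** (`S = (2β)⁻¹P⁻¹` the covariance):
`E₀[Q_AQ_BN] − E₀[Q_AQ_B]·E₀[N] = Σ_{aa'bb'} L⁰_{aa'}L^T_{bb'}·(72 connected pairings in S)`. -/
theorem gauss_centredForm_centredForm_mul_four_connected (P : Matrix ι ι ℝ) (hP : P.PosDef) {β : ℝ} (hβ : 0 < β) (S : ι → ι → ℝ)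
    (hS : ∀ i j, S i j = (2 * β)⁻¹ * P⁻¹ i j) (LA LB : ι → ι → ℝ) (n₀ n₁ n₂ n₃ : ι) :
    (∫ v : ι → ℝ, (∑ a, ∑ a', LA a a' * (v a * v a' - S a a')) * (∑ b, ∑ b', LB b b' * (v b * v b' - S b b')) *
          (v n₀ * v n₁ * v n₂ * v n₃) * Real.exp (-(β * (v ⬝ᵥ P *ᵥ v)))) / (∫ v : ι → ℝ, Real.exp (-(β * (v ⬝ᵥ P *ᵥ v)))) -
        (∫ v : ι → ℝ, (∑ a, ∑ a', LA a a' * (v a * v a' - S a a')) * (∑ b, ∑ b', LB b b' * (v b * v b' - S b b')) *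
            Real.exp (-(β * (v ⬝ᵥ P *ᵥ v)))) / (∫ v : ι → ℝ, Real.exp (-(β * (v ⬝ᵥ P *ᵥ v)))) *
          ((∫ v : ι → ℝ, v n₀ * v n₁ * v n₂ * v n₃ * Real.exp (-(β * (v ⬝ᵥ P *ᵥ v)))) / (∫ v : ι → ℝ, Real.exp (-(β * (v ⬝ᵥ P *ᵥ v))))) =
      ∑ a, ∑ a', ∑ b, ∑ b', LA a a' * LB b b' *
        (S a b * S a' n₀ * S b' n₁ * S n₂ n₃ +
        S a b * S a' n₀ * S b' n₂ * S n₁ n₃ +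
        S a b * S a' n₀ * S b' n₃ * S n₁ n₂ +
        S a b * S a' n₁ * S b' n₀ * S n₂ n₃ +
        S a b * S a' n₁ * S b' n₂ * S n₀ n₃ +
        S a b * S a' n₁ * S b' n₃ * S n₀ n₂ +
        S a b * S a' n₂ * S b' n₀ * S n₁ n₃ +
        S a b * S a' n₂ * S b' n₁ * S n₀ n₃ +
        S a b * S a' n₂ * S b' n₃ * S n₀ n₁ +
        S a b * S a' n₃ * S b' n₀ * S n₁ n₂ +
        S a b * S a' n₃ * S b' n₁ * S n₀ n₂ +
        S a b * S a' n₃ * S b' n₂ * S n₀ n₁ +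
        S a b' * S a' n₀ * S b n₁ * S n₂ n₃ +
        S a b' * S a' n₀ * S b n₂ * S n₁ n₃ +
        S a b' * S a' n₀ * S b n₃ * S n₁ n₂ +
        S a b' * S a' n₁ * S b n₀ * S n₂ n₃ +
        S a b' * S a' n₁ * S b n₂ * S n₀ n₃ +
        S a b' * S a' n₁ * S b n₃ * S n₀ n₂ +
        S a b' * S a' n₂ * S b n₀ * S n₁ n₃ +
        S a b' * S a' n₂ * S b n₁ * S n₀ n₃ +
        S a b' * S a' n₂ * S b n₃ * S n₀ n₁ +
        S a b' * S a' n₃ * S b n₀ * S n₁ n₂ +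
        S a b' * S a' n₃ * S b n₁ * S n₀ n₂ +
        S a b' * S a' n₃ * S b n₂ * S n₀ n₁ +
        S a n₀ * S a' b * S b' n₁ * S n₂ n₃ +
        S a n₀ * S a' b * S b' n₂ * S n₁ n₃ +
        S a n₀ * S a' b * S b' n₃ * S n₁ n₂ +
        S a n₀ * S a' b' * S b n₁ * S n₂ n₃ +
        S a n₀ * S a' b' * S b n₂ * S n₁ n₃ +
        S a n₀ * S a' b' * S b n₃ * S n₁ n₂ +
        S a n₀ * S a' n₁ * S b n₂ * S b' n₃ +
        S a n₀ * S a' n₁ * S b n₃ * S b' n₂ +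
        S a n₀ * S a' n₂ * S b n₁ * S b' n₃ +
        S a n₀ * S a' n₂ * S b n₃ * S b' n₁ +
        S a n₀ * S a' n₃ * S b n₁ * S b' n₂ +
        S a n₀ * S a' n₃ * S b n₂ * S b' n₁ +
        S a n₁ * S a' b * S b' n₀ * S n₂ n₃ +
        S a n₁ * S a' b * S b' n₂ * S n₀ n₃ +
        S a n₁ * S a' b * S b' n₃ * S n₀ n₂ +
        S a n₁ * S a' b' * S b n₀ * S n₂ n₃ +
        S a n₁ * S a' b' * S b n₂ * S n₀ n₃ +
        S a n₁ * S a' b' * S b n₃ * S n₀ n₂ +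
        S a n₁ * S a' n₀ * S b n₂ * S b' n₃ +
        S a n₁ * S a' n₀ * S b n₃ * S b' n₂ +
        S a n₁ * S a' n₂ * S b n₀ * S b' n₃ +
        S a n₁ * S a' n₂ * S b n₃ * S b' n₀ +
        S a n₁ * S a' n₃ * S b n₀ * S b' n₂ +
        S a n₁ * S a' n₃ * S b n₂ * S b' n₀ +
        S a n₂ * S a' b * S b' n₀ * S n₁ n₃ +
        S a n₂ * S a' b * S b' n₁ * S n₀ n₃ +
        S a n₂ * S a' b * S b' n₃ * S n₀ n₁ +
        S a n₂ * S a' b' * S b n₀ * S n₁ n₃ +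
        S a n₂ * S a' b' * S b n₁ * S n₀ n₃ +
        S a n₂ * S a' b' * S b n₃ * S n₀ n₁ +
        S a n₂ * S a' n₀ * S b n₁ * S b' n₃ +
        S a n₂ * S a' n₀ * S b n₃ * S b' n₁ +
        S a n₂ * S a' n₁ * S b n₀ * S b' n₃ +
        S a n₂ * S a' n₁ * S b n₃ * S b' n₀ +
        S a n₂ * S a' n₃ * S b n₀ * S b' n₁ +
        S a n₂ * S a' n₃ * S b n₁ * S b' n₀ +
        S a n₃ * S a' b * S b' n₀ * S n₁ n₂ +
        S a n₃ * S a' b * S b' n₁ * S n₀ n₂ +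
        S a n₃ * S a' b * S b' n₂ * S n₀ n₁ +
        S a n₃ * S a' b' * S b n₀ * S n₁ n₂ +
        S a n₃ * S a' b' * S b n₁ * S n₀ n₂ +
        S a n₃ * S a' b' * S b n₂ * S n₀ n₁ +
        S a n₃ * S a' n₀ * S b n₁ * S b' n₂ +
        S a n₃ * S a' n₀ * S b n₂ * S b' n₁ +
        S a n₃ * S a' n₁ * S b n₀ * S b' n₂ +
        S a n₃ * S a' n₁ * S b n₂ * S b' n₀ +
        S a n₃ * S a' n₂ * S b n₀ * S b' n₁ +
        S a n₃ * S a' n₂ * S b n₁ * S b' n₀) := by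
  obtain ⟨R, hRP, hR, htr⟩ := integral_mul_exp_quadForm_eq_integral_legs P hP hβ
  set e := Fintype.equivFin ι with he
  set μ : Measure (Fin (Fintype.card ι) → ℝ) :=
    Measure.pi (fun _ : Fin (Fintype.card ι) => gaussianReal 0 (Real.toNNReal (2 * β)⁻¹)) with hμ
  set Z : ℝ := Real.sqrt (Real.pi / β) ^ Fintype.card ι / |R.det| with hZ
  have hZpos : 0 < Z := div_pos (pow_pos (Real.sqrt_pos.mpr (div_pos Real.pi_pos hβ)) _) (abs_pos.mpr hR)
  set X : (Fin (Fintype.card ι) → ℝ) → (Fin (Fintype.card ι) → ℝ) → ℝ := fun ℓ u => ℓ ⬝ᵥ (R⁻¹ *ᵥ u) with hX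
  have hGP : IsGaussianProcess X μ := isGaussianProcess_legs R β
  have h0 : ∀ ℓ, ∫ u, X ℓ u ∂μ = 0 := integral_leg_eq_zero R β
  set t : ι → (Fin (Fintype.card ι) → ℝ) := fun i => Pi.single (e i) (1 : ℝ) with ht
  set φ : (Fin (Fintype.card ι) → ℝ) → (ι → ℝ) := fun u i => (R⁻¹ *ᵥ u) (e i) with hφ
  have hXt : ∀ i u, X (t i) u = φ u i := fun i u => by simp only [hX, ht, hφ, single_one_dotProduct]
  set C : (Fin (Fintype.card ι) → ℝ) → (Fin (Fintype.card ι) → ℝ) → ℝ := fun s s' => ∫ u, X s u * X s' u ∂μ with hC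
  have hCS : ∀ i j, C (t i) (t j) = S i j := fun i j => by rw [hS]; exact two_point_legs P hβ hRP i j
  have hnorm : ∫ v : ι → ℝ, Real.exp (-(β * (v ⬝ᵥ P *ᵥ v))) = Z := by
    have h := htr (fun _ => 1)
    simp only [one_mul] at h
    rw [h, integral_const, smul_eq_mul, probReal_univ, one_mul, mul_one]
  have hE : ∀ F : (ι → ℝ) → ℝ, (∫ v : ι → ℝ, F v * Real.exp (-(β * (v ⬝ᵥ P *ᵥ v)))) /
      (∫ v : ι → ℝ, Real.exp (-(β * (v ⬝ᵥ P *ᵥ v)))) = ∫ u, F (φ u) ∂μ := fun F => by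
    rw [hnorm, htr F, mul_div_cancel_left₀ _ hZpos.ne']
  rw [hE (fun v => (∑ a, ∑ a', LA a a' * (v a * v a' - S a a')) * (∑ b, ∑ b', LB b b' * (v b * v b' - S b b')) *
      (v n₀ * v n₁ * v n₂ * v n₃)),
    hE (fun v => (∑ a, ∑ a', LA a a' * (v a * v a' - S a a')) * (∑ b, ∑ b', LB b b' * (v b * v b' - S b b'))),
    hE (fun v => v n₀ * v n₁ * v n₂ * v n₃)]
  have key := WickPairCubic.integral_centredForm_centredForm_mul_four_connected hGP h0 t C (fun _ _ => rfl) LA LB n₀ n₁ n₂ n₃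
    (QA := fun u => ∑ a, ∑ a', LA a a' * (φ u a * φ u a' - S a a')) (QB := fun u => ∑ b, ∑ b', LB b b' * (φ u b * φ u b' - S b b'))
    (fun u => by simp only [hXt, hCS]) (fun u => by simp only [hXt, hCS])
  simp only [hXt, hCS] at key
  rw [← key]

end Chart

end Summit.QuantumFields.YangMills.Theorems.AllWindowsColdBoxBoxHighLine

end
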